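import Mathlib
import Literature.Analysis.FunctionSpaces.SobolevDomain

/-!
# Crux `EulerZoomLiouville.PowerGaugeEulerLiouville` (stmt-NavierStokesRegularity-19832), weak stratum, line `weak_axisym` (ns-idea-11 g9):
# TOOLS for `stub_casimirRace` (X2) — the fixed renormalisation `β_q` and the radial test functions

Route №10 `EulerZoomLiouville`, crux E = stmt-NavierStokesRegularity-19832; width seat ns-ezl-w2 g6 under the LEAD ns-typeII-p2 g15.
Two simplifications of the ideator's 5-step sketch for X2 (ns-ezl-w2 g6 bus 05:52Z): (a) NO ε-LIMIT — the FIXED renormalisation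
`β_q(s) = (1 + s²)^{q/2} − 1` (`0 < q < 1`) is `C¹` with `|β_q′| ≤ q`, `0 ≤ β_q(s) ≤ |s|^q`, `β_q(s) > 0` for `s ≠ 0`, and satisfies the pointwise
RACE INEQUALITY `q·β_q(s) ≤ s·β_q′(s)` (`= q(1 − (1+s²)^{q/2−1}) ≥ 0`), so the renormalised Casimir law with this one `β` already carries the
damping sign; (b) NO THIN FAST SET — the weighted AM–GM bound `|s|^{2q} ≤ qλs² + (1−q)λ^{−q/(1−q)}` replaces Chebyshev + Hölder.
Radial tests `ψ_R(y) = smoothTransition(2 − ‖y‖²/R²)`: smooth, `= 1` on `B_R`, `= 0` off `B_{2R}`, `0 ≤ ψ_R ≤ 1`, and for `γ ≥ 0`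
`Dψ_R(y)[γy + v] ≤ (4M/R)‖v‖` (`M` a bound of `smoothTransition′`), the similarity part having the good sign.

WHAT THIS IS NOT: not NS, not E, not X2 itself (the member is the sequel file) — class-free calculus. [folklore]
-/

noncomputable section

set_option linter.dupNamespace false

open MeasureTheory Set Filter Topology Metric Function TopologicalSpace
open scoped ENNReal NNReal RealInnerProductSpace ContDiff

namespace Summit.NavierStokesRegularity.NavierStokesRegularity.Theorems.PowerGaugeEulerLiouville.WeakAxisym

open Literature.Analysis Literature.Analysis.FunctionSpaces

/-! ### The fixed renormalisation `β_q(s) = (1 + s²)^{q/2} − 1` -/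

section Beta

variable {q : ℝ}

/-- `1 + s² > 0`. [folklore] -/
private theorem one_add_sq_pos (s : ℝ) : 0 < 1 + s ^ 2 := by positivity

/-- `β_q′(s) = q·s·(1 + s²)^{q/2 − 1}`. -/
theorem hasDerivAt_betaq (q s : ℝ) : HasDerivAt (fun s : ℝ => (1 + s ^ 2) ^ (q / 2) - 1) (q * s * (1 + s ^ 2) ^ (q / 2 - 1)) s := by
  have h1 : HasDerivAt (fun s : ℝ => 1 + s ^ 2) (2 * s) s := by
    have := (hasDerivAt_pow 2 s).const_add 1
    simpa using this
  have h2 := h1.rpow_const (p := q / 2) (Or.inl (one_add_sq_pos s).ne')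
  have h3 : HasDerivAt (fun s : ℝ => (1 + s ^ 2) ^ (q / 2) - 1) (2 * s * (q / 2) * (1 + s ^ 2) ^ (q / 2 - 1)) s := h2.sub_const 1
  convert h3 using 1
  ring

/-- `β_q′ = q·s·(1+s²)^{q/2−1}` as an equation for `deriv`. [folklore] -/
theorem deriv_betaq (q s : ℝ) : deriv (fun s : ℝ => (1 + s ^ 2) ^ (q / 2) - 1) s = q * s * (1 + s ^ 2) ^ (q / 2 - 1) := (hasDerivAt_betaq q s).deriv

/-- `β_q ∈ C¹`. -/
theorem contDiff_betaq (q : ℝ) : ContDiff ℝ 1 (fun s : ℝ => (1 + s ^ 2) ^ (q / 2) - 1) :=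
  ((contDiff_const.add (contDiff_id.pow 2)).rpow_const_of_ne fun s => (one_add_sq_pos s).ne').sub contDiff_const

/-- `|β_q′(s)| ≤ q` for `0 ≤ q < 2`…; we only need `0 < q ≤ 1`: `|s|(1+s²)^{q/2−1} ≤ |s|(1+s²)^{−1/2} ≤ 1`. -/
theorem abs_deriv_betaq_le (hq0 : 0 ≤ q) (hq1 : q ≤ 1) (s : ℝ) : ‖deriv (fun s : ℝ => (1 + s ^ 2) ^ (q / 2) - 1) s‖ ≤ q := by
  rw [deriv_betaq, Real.norm_eq_abs]
  have hx : 1 ≤ 1 + s ^ 2 := by nlinarith [sq_nonneg s]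
  have hxpos : 0 < 1 + s ^ 2 := one_add_sq_pos s
  -- `(1+s²)^{q/2−1} ≤ (1+s²)^{−1/2}`
  have h1 : (1 + s ^ 2) ^ (q / 2 - 1) ≤ (1 + s ^ 2) ^ (-(1 / 2 : ℝ)) :=
    Real.rpow_le_rpow_of_exponent_le hx (by linarith)
  -- `|s| ≤ (1+s²)^{1/2}`
  have h2 : |s| * (1 + s ^ 2) ^ (-(1 / 2 : ℝ)) ≤ 1 := by
    rw [Real.rpow_neg hxpos.le, ← Real.sqrt_eq_rpow, ← div_eq_mul_inv, div_le_one (Real.sqrt_pos.2 hxpos)]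
    rw [show |s| = Real.sqrt (s ^ 2) by rw [Real.sqrt_sq_eq_abs]]
    exact Real.sqrt_le_sqrt (by linarith)
  have hp : 0 ≤ (1 + s ^ 2) ^ (q / 2 - 1) := Real.rpow_nonneg hxpos.le _
  calc |q * s * (1 + s ^ 2) ^ (q / 2 - 1)| = q * (|s| * (1 + s ^ 2) ^ (q / 2 - 1)) := by
        rw [abs_mul, abs_mul, abs_of_nonneg hq0, abs_of_nonneg hp]; ring
    _ ≤ q * (|s| * (1 + s ^ 2) ^ (-(1 / 2 : ℝ))) := by gcongr
    _ ≤ q * 1 := by gcongr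
    _ = q := mul_one q

/-- `0 ≤ β_q(s)`. -/
theorem betaq_nonneg (hq0 : 0 ≤ q) (s : ℝ) : 0 ≤ ((1 + s ^ 2) ^ (q / 2) - 1) := by
  have hx : 1 ≤ 1 + s ^ 2 := by nlinarith [sq_nonneg s]
  have := Real.one_le_rpow hx (by linarith : 0 ≤ q / 2)
  linarith

/-- `β_q(s) ≤ |s|^q` (subadditivity of `x ↦ x^{q/2}`, `q ≤ 2`). -/
theorem betaq_le_abs_rpow (hq0 : 0 ≤ q) (hq2 : q ≤ 2) (s : ℝ) : ((1 + s ^ 2) ^ (q / 2) - 1) ≤ |s| ^ q := by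
  have h := Real.rpow_add_le_add_rpow (zero_le_one) (sq_nonneg s) (by linarith : 0 ≤ q / 2) (by linarith : q / 2 ≤ 1)
  rw [Real.one_rpow] at h
  have e : (s ^ 2) ^ (q / 2) = |s| ^ q := by
    rw [← sq_abs, ← Real.rpow_natCast, ← Real.rpow_mul (abs_nonneg s)]; norm_num; ring_nf
  linarith [e.le, e.ge]

/-- `β_q(s) > 0` for `s ≠ 0` (`q > 0`). -/
theorem betaq_pos (hq0 : 0 < q) {s : ℝ} (hs : s ≠ 0) : 0 < ((1 + s ^ 2) ^ (q / 2) - 1) := by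
  have hx : 1 < 1 + s ^ 2 := by have := sq_pos_of_ne_zero hs; linarith
  have := Real.one_lt_rpow hx (by linarith : 0 < q / 2)
  linarith

/-- `β_q(s) = 0 ↔ s = 0` (`q > 0`). -/
theorem betaq_eq_zero_iff (hq0 : 0 < q) {s : ℝ} : ((1 + s ^ 2) ^ (q / 2) - 1) = 0 ↔ s = 0 := by
  constructor
  · intro h
    by_contra hs
    exact (betaq_pos hq0 hs).ne' h
  · intro h
    simp [h]

/-- **THE RACE INEQUALITY**: `q·β_q(s) ≤ s·β_q′(s)` (`= q(1 − (1+s²)^{q/2−1}) ≥ 0`, `0 ≤ q ≤ 2`). -/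
theorem mul_betaq_le_mul_deriv (hq0 : 0 ≤ q) (hq2 : q ≤ 2) (s : ℝ) : q * ((1 + s ^ 2) ^ (q / 2) - 1) ≤ s * deriv (fun s : ℝ => (1 + s ^ 2) ^ (q / 2) - 1) s := by
  rw [deriv_betaq]
  have hxpos : 0 < 1 + s ^ 2 := one_add_sq_pos s
  have hx : 1 ≤ 1 + s ^ 2 := by nlinarith [sq_nonneg s]
  have e := Real.rpow_add hxpos (q / 2 - 1) 1
  rw [sub_add_cancel, Real.rpow_one] at e
  have hle : (1 + s ^ 2) ^ (q / 2 - 1) ≤ 1 := Real.rpow_le_one_of_one_le_of_nonpos hx (by linarith)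
  have hp : 0 ≤ (1 + s ^ 2) ^ (q / 2 - 1) := Real.rpow_nonneg hxpos.le _
  rw [e]
  nlinarith [mul_nonneg hq0 (sub_nonneg.2 hle), sq_nonneg s, mul_nonneg hq0 hp]

/-- **Weighted AM–GM for the power `2q`**: `|s|^{2q} ≤ q·λ·s² + (1−q)·λ^{−q/(1−q)}` for `0 < q < 1`, `λ > 0`. -/
theorem abs_rpow_two_mul_le {lam : ℝ} (hq0 : 0 < q) (hq1 : q < 1) (hlam : 0 < lam) (s : ℝ) :
    |s| ^ (2 * q) ≤ q * (lam * s ^ 2) + (1 - q) * lam ^ (-(q / (1 - q))) := by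
  have h := Real.geom_mean_le_arith_mean2_weighted hq0.le (by linarith : 0 ≤ 1 - q) (by positivity : 0 ≤ lam * s ^ 2)
    (Real.rpow_nonneg hlam.le (-(q / (1 - q)))) (by ring : q + (1 - q) = 1)
  have e1 : (lam * s ^ 2) ^ q = lam ^ q * |s| ^ (2 * q) := by
    rw [Real.mul_rpow hlam.le (sq_nonneg s), ← sq_abs, ← Real.rpow_natCast, ← Real.rpow_mul (abs_nonneg s)]
    norm_num
  have hq1' : (1 : ℝ) - q ≠ 0 := by intro h0; linarith
  have e2 : (lam ^ (-(q / (1 - q)))) ^ (1 - q) = lam ^ (-q) := by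
    rw [← Real.rpow_mul hlam.le]
    congr 1
    field_simp
  rw [e1, e2] at h
  calc |s| ^ (2 * q) = lam ^ q * |s| ^ (2 * q) * lam ^ (-q) := by
        rw [mul_assoc, mul_comm (|s| ^ (2 * q)), ← mul_assoc, ← Real.rpow_add hlam, add_neg_cancel, Real.rpow_zero, one_mul]
    _ ≤ q * (lam * s ^ 2) + (1 - q) * lam ^ (-(q / (1 - q))) := h

/-- `β_q(s)² ≤ q·λ·s² + (1−q)·λ^{−q/(1−q)}` (`0 < q < 1`, `λ > 0`). -/
theorem betaq_sq_le {lam : ℝ} (hq0 : 0 < q) (hq1 : q < 1) (hlam : 0 < lam) (s : ℝ) :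
    ((1 + s ^ 2) ^ (q / 2) - 1) ^ 2 ≤ q * (lam * s ^ 2) + (1 - q) * lam ^ (-(q / (1 - q))) := by
  have h1 : ((1 + s ^ 2) ^ (q / 2) - 1) ^ 2 ≤ (|s| ^ q) ^ 2 :=
    pow_le_pow_left₀ (betaq_nonneg hq0.le s) (betaq_le_abs_rpow hq0.le (by linarith) s) 2
  have e : (|s| ^ q) ^ 2 = |s| ^ (2 * q) := by
    rw [← Real.rpow_natCast, ← Real.rpow_mul (abs_nonneg s)]; ring_nf
  rw [e] at h1
  exact h1.trans (abs_rpow_two_mul_le hq0 hq1 hlam s)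

end Beta


/-! ### The smooth transition: sign and bound of the derivative -/

section Sigma

/-- `σ′ ≥ 0` (the smooth transition is monotone). [folklore] -/
private theorem deriv_smoothTransition_nonneg (t : ℝ) : 0 ≤ deriv Real.smoothTransition t :=
  Real.smoothTransition.monotone.deriv_nonneg

/-- `σ′(t) = 0` for `t < 0`. [folklore] -/
private theorem deriv_smoothTransition_of_neg {t : ℝ} (ht : t < 0) : deriv Real.smoothTransition t = 0 := by
  have h : Real.smoothTransition =ᶠ[𝓝 t] fun _ => (0 : ℝ) := by
    filter_upwards [Iio_mem_nhds ht] with s hs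
    exact Real.smoothTransition.zero_of_nonpos (le_of_lt hs)
  rw [h.deriv_eq, deriv_const]

/-- `σ′(t) = 0` for `t > 1`. [folklore] -/
private theorem deriv_smoothTransition_of_one_lt {t : ℝ} (ht : 1 < t) : deriv Real.smoothTransition t = 0 := by
  have h : Real.smoothTransition =ᶠ[𝓝 t] fun _ => (1 : ℝ) := by
    filter_upwards [Ioi_mem_nhds ht] with s hs
    exact Real.smoothTransition.one_of_one_le (le_of_lt hs)
  rw [h.deriv_eq, deriv_const]

/-- The derivative of the smooth transition is bounded: `0 ≤ σ′ ≤ M`. -/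
theorem exists_bound_deriv_smoothTransition : ∃ M : ℝ, 0 ≤ M ∧ ∀ t : ℝ, deriv Real.smoothTransition t ≤ M := by
  have hc : Continuous (deriv Real.smoothTransition) :=
    (Real.smoothTransition.contDiff (n := 1)).continuous_deriv le_rfl
  obtain ⟨C, hC⟩ := isCompact_Icc.exists_bound_of_continuousOn (hc.continuousOn (s := Icc (0 : ℝ) 1))
  refine ⟨max C 0, le_max_right _ _, fun t => ?_⟩
  by_cases h0 : t < 0
  · rw [deriv_smoothTransition_of_neg h0]; exact le_max_right _ _
  by_cases h1 : 1 < t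
  · rw [deriv_smoothTransition_of_one_lt h1]; exact le_max_right _ _
  · have ht : t ∈ Icc (0 : ℝ) 1 := ⟨not_lt.1 h0, not_lt.1 h1⟩
    exact ((le_abs_self _).trans ((Real.norm_eq_abs _).symm.le.trans (hC t ht))).trans (le_max_left _ _)

end Sigma

/-! ### Radial tests `ψ_R(y) = σ(2 − ‖y‖²/R²)` -/

section RadialTest

/-- `ψ_R` is smooth. [folklore] -/
theorem contDiff_psiR (R : ℝ) {n : ℕ∞} : ContDiff ℝ n (fun y : EuclideanSpace ℝ (Fin 3) => Real.smoothTransition (2 - (R ^ 2)⁻¹ * ‖y‖ ^ 2)) :=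
  (Real.smoothTransition.contDiff (n := n)).comp (contDiff_const.sub (contDiff_const.mul (contDiff_norm_sq ℝ)))

/-- `0 ≤ ψ_R`. [folklore] -/
theorem psiR_nonneg (R : ℝ) (y : EuclideanSpace ℝ (Fin 3)) : 0 ≤ Real.smoothTransition (2 - (R ^ 2)⁻¹ * ‖y‖ ^ 2) := Real.smoothTransition.nonneg _

/-- `ψ_R ≤ 1`. [folklore] -/
theorem psiR_le_one (R : ℝ) (y : EuclideanSpace ℝ (Fin 3)) : Real.smoothTransition (2 - (R ^ 2)⁻¹ * ‖y‖ ^ 2) ≤ 1 := Real.smoothTransition.le_one _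

/-- `ψ_R = 1` on `B̄_R`. [folklore] -/
theorem psiR_eq_one_of_le {R : ℝ} (hR : 0 < R) {y : EuclideanSpace ℝ (Fin 3)} (hy : ‖y‖ ≤ R) : Real.smoothTransition (2 - (R ^ 2)⁻¹ * ‖y‖ ^ 2) = 1 := by
  apply Real.smoothTransition.one_of_one_le
  have hR2 : 0 < R ^ 2 := by positivity
  have h : ‖y‖ ^ 2 ≤ R ^ 2 := pow_le_pow_left₀ (norm_nonneg _) hy 2
  have : (R ^ 2)⁻¹ * ‖y‖ ^ 2 ≤ 1 := by rw [inv_mul_le_iff₀ hR2]; linarith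
  linarith

/-- `ψ_R = 0` off `B_{2R}`. [folklore] -/
theorem psiR_eq_zero_of_le {R : ℝ} (hR : 0 < R) {y : EuclideanSpace ℝ (Fin 3)} (hy : 2 * R ≤ ‖y‖) : Real.smoothTransition (2 - (R ^ 2)⁻¹ * ‖y‖ ^ 2) = 0 := by
  apply Real.smoothTransition.zero_of_nonpos
  have hR2 : 0 < R ^ 2 := by positivity
  have h : (2 * R) ^ 2 ≤ ‖y‖ ^ 2 := pow_le_pow_left₀ (by positivity) hy 2
  have : 4 ≤ (R ^ 2)⁻¹ * ‖y‖ ^ 2 := by rw [le_inv_mul_iff₀ hR2]; linarith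
  linarith

/-- `ψ_R` has compact support. [folklore] -/
theorem hasCompactSupport_psiR {R : ℝ} (hR : 0 < R) : HasCompactSupport (fun y : EuclideanSpace ℝ (Fin 3) => Real.smoothTransition (2 - (R ^ 2)⁻¹ * ‖y‖ ^ 2)) := by
  refine HasCompactSupport.of_support_subset_isCompact (isCompact_closedBall (0 : EuclideanSpace ℝ (Fin 3)) (2 * R)) ?_
  intro y hy
  rw [mem_closedBall, dist_zero_right]
  by_contra h
  exact hy (psiR_eq_zero_of_le hR (not_le.1 h).le)

/-- `ψ_R` is a test function on `ℝ³`. [folklore] -/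
theorem isTestFunctionOn_psiR {R : ℝ} (hR : 0 < R) :
    IsTestFunctionOn (⊤ : Opens (EuclideanSpace ℝ (Fin 3))) (fun y : EuclideanSpace ℝ (Fin 3) => Real.smoothTransition (2 - (R ^ 2)⁻¹ * ‖y‖ ^ 2)) :=
  ⟨contDiff_psiR R, hasCompactSupport_psiR hR, fun _ _ => trivial⟩

/-- `Dψ_R(y)[w] = −2R⁻²·σ′(2 − R⁻²‖y‖²)·⟪y, w⟫`. -/
theorem hasFDerivAt_psiR (R : ℝ) (y : EuclideanSpace ℝ (Fin 3)) :
    HasFDerivAt (fun y : EuclideanSpace ℝ (Fin 3) => Real.smoothTransition (2 - (R ^ 2)⁻¹ * ‖y‖ ^ 2)) ((deriv Real.smoothTransition (2 - (R ^ 2)⁻¹ * ‖y‖ ^ 2)) •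
      (-((R ^ 2)⁻¹ • ((2 : ℕ) • innerSL ℝ y)))) y := by
  have h1 : HasFDerivAt (fun x : EuclideanSpace ℝ (Fin 3) => (R ^ 2)⁻¹ * ‖x‖ ^ 2) ((R ^ 2)⁻¹ • ((2 : ℕ) • innerSL ℝ y)) y := by
    have h := (hasStrictFDerivAt_norm_sq y).hasFDerivAt.const_mul ((R ^ 2)⁻¹)
    simpa using h
  have h2 : HasFDerivAt (fun x : EuclideanSpace ℝ (Fin 3) => 2 - (R ^ 2)⁻¹ * ‖x‖ ^ 2) (-((R ^ 2)⁻¹ • ((2 : ℕ) • innerSL ℝ y))) y :=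
    h1.const_sub 2
  have h3 : HasDerivAt Real.smoothTransition (deriv Real.smoothTransition (2 - (R ^ 2)⁻¹ * ‖y‖ ^ 2)) (2 - (R ^ 2)⁻¹ * ‖y‖ ^ 2) :=
    ((Real.smoothTransition.contDiff (n := 1)).differentiable one_ne_zero _).hasDerivAt
  exact h3.comp_hasFDerivAt y h2

/-- `Dψ_R(y)[w] = −2R⁻²σ′(2 − R⁻²‖y‖²)⟪y, w⟫` as an equation for `fderiv`. [folklore] -/
theorem fderiv_psiR_apply (R : ℝ) (y w : EuclideanSpace ℝ (Fin 3)) :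
    fderiv ℝ (fun y : EuclideanSpace ℝ (Fin 3) => Real.smoothTransition (2 - (R ^ 2)⁻¹ * ‖y‖ ^ 2)) y w = -(2 * (R ^ 2)⁻¹ * deriv Real.smoothTransition (2 - (R ^ 2)⁻¹ * ‖y‖ ^ 2)) * ⟪y, w⟫ := by
  rw [(hasFDerivAt_psiR R y).fderiv, two_nsmul]
  simp only [_root_.smul_apply, _root_.neg_apply, _root_.add_apply, smul_eq_mul, innerSL_apply_apply]
  ring

/-- `Dψ_R` vanishes off `B_{2R}`. -/
theorem fderiv_psiR_apply_eq_zero {R : ℝ} (hR : 0 < R) {y : EuclideanSpace ℝ (Fin 3)} (hy : 2 * R ≤ ‖y‖) (w : EuclideanSpace ℝ (Fin 3)) :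
    fderiv ℝ (fun y : EuclideanSpace ℝ (Fin 3) => Real.smoothTransition (2 - (R ^ 2)⁻¹ * ‖y‖ ^ 2)) y w = 0 := by
  rw [fderiv_psiR_apply]
  have hR2 : 0 < R ^ 2 := by positivity
  have h : (2 * R) ^ 2 ≤ ‖y‖ ^ 2 := pow_le_pow_left₀ (by positivity) hy 2
  have h4 : 4 ≤ (R ^ 2)⁻¹ * ‖y‖ ^ 2 := by rw [le_inv_mul_iff₀ hR2]; linarith
  rw [deriv_smoothTransition_of_neg (by linarith)]
  ring

/-- **The transport derivative of the radial test**: for `γ ≥ 0` and `σ′ ≤ M`,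
`Dψ_R(y)[γy + v] ≤ (4M/R)‖v‖` (the similarity part `−2R⁻²σ′γ‖y‖²` has the good sign; `σ′ = 0` off `B_{2R}`). -/
theorem fderiv_psiR_transport_le {R γ M : ℝ} (hR : 0 < R) (hγ : 0 ≤ γ) (hM0 : 0 ≤ M)
    (hM : ∀ t : ℝ, deriv Real.smoothTransition t ≤ M) (y v : EuclideanSpace ℝ (Fin 3)) :
    fderiv ℝ (fun y : EuclideanSpace ℝ (Fin 3) => Real.smoothTransition (2 - (R ^ 2)⁻¹ * ‖y‖ ^ 2)) y (γ • y + v) ≤ 4 * M / R * ‖v‖ := by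
  by_cases hy : 2 * R ≤ ‖y‖
  · rw [fderiv_psiR_apply_eq_zero hR hy]; positivity
  · push Not at hy
    rw [fderiv_psiR_apply, inner_add_right, real_inner_smul_right, real_inner_self_eq_norm_sq]
    set c : ℝ := 2 * (R ^ 2)⁻¹ * deriv Real.smoothTransition (2 - (R ^ 2)⁻¹ * ‖y‖ ^ 2) with hc
    have hc0 : 0 ≤ c := by rw [hc]; have := deriv_smoothTransition_nonneg (2 - (R ^ 2)⁻¹ * ‖y‖ ^ 2); positivity
    have hcle : c ≤ 2 * (R ^ 2)⁻¹ * M := by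
      rw [hc]; exact mul_le_mul_of_nonneg_left (hM _) (by positivity)
    have hcs : |⟪y, v⟫| ≤ ‖y‖ * ‖v‖ := abs_real_inner_le_norm y v
    have h1 : -c * (γ * ‖y‖ ^ 2 + ⟪y, v⟫) ≤ c * (‖y‖ * ‖v‖) := by
      have : -⟪y, v⟫ ≤ ‖y‖ * ‖v‖ := by linarith [(abs_le.1 (hcs.trans le_rfl)).1]
      nlinarith [mul_nonneg hc0 (mul_nonneg hγ (sq_nonneg ‖y‖)), mul_nonneg hc0 (sub_nonneg.2 this)]
    have h2 : c * (‖y‖ * ‖v‖) ≤ 2 * (R ^ 2)⁻¹ * M * (2 * R * ‖v‖) := by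
      have := mul_le_mul hcle (mul_le_mul_of_nonneg_right hy.le (norm_nonneg v)) (by positivity) (by positivity)
      linarith
    have e : 2 * (R ^ 2)⁻¹ * M * (2 * R * ‖v‖) = 4 * M / R * ‖v‖ := by field_simp; ring
    linarith

/-- `|Dψ_R(y)[w]| ≤ (4M/R)‖w‖` everywhere. -/
theorem abs_fderiv_psiR_apply_le {R M : ℝ} (hR : 0 < R) (hM0 : 0 ≤ M) (hM : ∀ t : ℝ, deriv Real.smoothTransition t ≤ M)
    (y w : EuclideanSpace ℝ (Fin 3)) : |fderiv ℝ (fun y : EuclideanSpace ℝ (Fin 3) => Real.smoothTransition (2 - (R ^ 2)⁻¹ * ‖y‖ ^ 2)) y w| ≤ 4 * M / R * ‖w‖ := by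
  have h := fderiv_psiR_transport_le (γ := 0) hR le_rfl hM0 hM y w
  have h' := fderiv_psiR_transport_le (γ := 0) hR le_rfl hM0 hM y (-w)
  simp only [zero_smul, zero_add, map_neg, norm_neg] at h h'
  exact abs_le.2 ⟨by linarith, h⟩

end RadialTest

end Summit.NavierStokesRegularity.NavierStokesRegularity.Theorems.PowerGaugeEulerLiouville.WeakAxisym

end
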